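import Summits.BirchSwinnertonDyer.BirchSwinnertonDyer.Theorems.GenusKolyvaginAtTwoGenusPrimitiveSupplyAtTwoTwistingPrimeDepthClass
import Summits.BirchSwinnertonDyer.BirchSwinnertonDyer.Theorems.GenusKolyvaginAtTwoGenusPrimitiveSupplyAtTwoTwistingPrimeGenusPair
import HarnessLib

/-!
# Route `GenusKolyvaginAtTwo`, crux #2 `GenusPrimitiveSupplyAtTwo` (stmt-BirchSwinnertonDyer-22136):
# KOLYVAGIN primes of depth `M` with class control; the GENUS PAIR at a depth-`M` Kolyvagin prime

Width seat `bsd-line-gk2-p4` g8, cell `bsd-f1-sign2`; helper (`--supports stmt-BirchSwinnertonDyer-22136`),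
eighth file of the twisting-prime series (after `…TwistingPrimeDepthClass`). THEOREMS ONLY: no definition,
no named fact, no `sorry`; no item is closed; BSD is not proved by any of this.

* §18 `exists_kolyvaginPrime_pow_not_mem_torsionLocalKer_pair` — `K` imaginary quadratic, `M ≥ 1`, `x, y`
  not dying on `Γ_{ℚ(E[2^M])}`, `m`, `N`, `B₀`: a prime `ℓ ∉ B₀`, `m ∣ ℓ + 1`, `IsKolyvaginPrime N W K 2 ℓ`
  (Gross) AND `FrobEqFrobInfty W K (2^M) ℓ` (DEPTH `M`: `Frob_ℓ = Frob_∞` on `K(E[2^M])`), with `x_ℓ ≠ 0`,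
  `y_ℓ ≠ 0`. The «K ↔ K_ℓ symmetry» primes of `Lines/genus-supply-local.md` §2 WITH class control.
* §19 `exists_kolyvaginPrime_pow_not_mem_torsionLocalKer_twin` / `…_not_selmerGroup_le_strictLocalKer_twin`
  (a class of `E` and a class of any model of `E^{(d)}`), and the CAPSTONE
  `exists_kolyvaginPrime_pow_genusPair_selmer_of_cor34i`: `cor34i_singleton_rat` → [`W` globally minimal,
  `Δ < 0`, `ρ̄₂` onto, `#Sel₂(W) = 4`; `K` imaginary quadratic; `Wd` globally minimal model of `W^{(d_K)}` with
  `#Sel₂(Wd) = 2`; some Selmer class of each NOT dying on `Γ_{ℚ(E[2^M])}`] → ∀ `B₀` ∃ prime `ℓ ∉ B₀`,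
  `ℓ ≡ 7 (8)`, Kolyvagin for `(E, K, 2)` of DEPTH `M` (`2^M ∣ ℓ + 1`, `2^M ∣ a_ℓ`), every elliptic model of
  `W^{(−ℓ)}` having `#Sel₂ = 2` and every elliptic model of `Wd^{(−ℓ)}` having `#Sel₂ = 1`. At `M = 2` this
  is the SUPPLY half (prime `ℓ` with `4 ∣ a_ℓ` + Sel₂-trivial even genus twist) of the LEAD's auxiliary-field
  form of U (`GenusKoly.multiGenusPrimitivityAtTwo_of_auxFieldPrimitive`, p615396), kernel-closed modulo
  cor34i (PRINT) and non-entanglement of the twin's Selmer class (the ENTANGLED exception of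
  `Lines/genus-supply-depthlaw.md` §2 made explicit); EXACT-INDEX₂ is untouched.

References: [MazurRubin2010] Remark 2.4, Prop. 3.3, Cor. 3.4 (i), Lemma 3.5; [GrossLMS1991] §3, §9;
[McCallumLMS1991] §3 Cor. 3.2, §4.
-/

set_option linter.dupNamespace false -- tree convention: `Summit.BirchSwinnertonDyer.BirchSwinnertonDyer.Theorems` (summit = sub-problem)
set_option autoImplicit false

noncomputable section

open scoped Classical Pointwise

namespace Summit.BirchSwinnertonDyer.BirchSwinnertonDyer.Theorems.GenusKolyTwistingPrime

open WeierstrassCurve NumberField IsDedekindDomain Field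
open Literature.NumberTheory.GaloisRepresentations Literature.NumberTheory.EllipticCurves
open Literature.NumberTheory

/-! ## §18 Over an imaginary quadratic `K`: KOLYVAGIN primes of depth `M` at which two classes are not strict -/

section DepthKolyvagin

variable (W : WeierstrassCurve ℚ) [W.IsElliptic] {K : Type} [Field K] [NumberField K]

/-- **KOLYVAGIN TWISTING PRIMES AT `2` OF DEPTH `M`, under non-entanglement at level `2^M`.** `W/ℚ`
elliptic with `Δ(W) < 0` and `ρ̄_{W,2}` onto, `K` imaginary quadratic, `M ≥ 1`, `x, y ∈ H¹(ℚ, E[2])`,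
`m ≥ 1`, `N ≥ 1`, `B₀` finite. HYPOTHESIS: `[x, h] ≠ 0` for some `h ∈ Γ_{ℚ(E[2^M])}`, and likewise for `y`
(neither class is inflated from `Gal(ℚ(E[2^M])/ℚ)`; automatic at `M = 1` for `x, y ≠ 0`). THEN there is a
prime `ℓ ∉ B₀` with `m ∣ ℓ + 1` which is a KOLYVAGIN PRIME for `(E, K, 2)` at level `N` in Gross's sense
(`ℓ ∤ 2 N d_K`, inert in `K`, `Frob_ℓ = Frob_∞` on `K(E[2])`) AND OF DEPTH `M` — `FrobEqFrobInfty W K (2^M) ℓ`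
(`Frob_ℓ = Frob_∞` on `K(E[2^M])`, so `2^M ∣ ℓ + 1` and `2^M ∣ a_ℓ`: `pow_dvd_add_one_of_frobEqFrobInfty`,
`pow_dvd_frobeniusTraceAt_of_frobEqFrobInfty`) — at which BOTH `x_ℓ ≠ 0` and `y_ℓ ≠ 0` in `H¹(ℚ_ℓ, E[2])`.
From `exists_twistingPrime_pair_pow` with `A = Γ_K` (index `2`: contains every commutator), the places
ramified in `K` avoided, inertness as in McCallum's Cor. 3.2 (`FrobeniusPlaces.exists_place_inert_of_not_mem_range`).
With `8·N·N' ∣ m` the auxiliary field `ℚ(√−ℓ)` is a prime Heegner field for `N` and `N'` with `2` split: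
the «K ↔ K_ℓ symmetry» primes of `Lines/genus-supply-local.md` §2, now WITH class control.
[cite: McCallumLMS1991, §3 Cor. 3.2, §4 (Kolyvagin primes of level M)] [cite: GrossLMS1991, §3 (3.1)–(3.3), §9 Prop. 9.6]
[cite: MazurRubin2010, Prop. 3.3 and Lemma 3.5] -/
theorem exists_kolyvaginPrime_pow_not_mem_torsionLocalKer_pair (hsurj : W.HasSurjectiveModNGaloisRep 2)
    (hΔ : W.Δ < 0) (hK : IsImaginaryQuadratic K) {M : ℕ} (hM : 1 ≤ M) {x y : galH1Torsion W (2 : ℤ)}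
    {m : ℕ} (hm : m ≠ 0) (N : ℕ) [NeZero N] (B₀ : Finset ℕ)
    (hx : ∃ h ∈ torsionFixing W ((2 ^ M : ℕ) : ℤ), h1Eval W (2 : ℤ) x h ≠ 0)
    (hy : ∃ h ∈ torsionFixing W ((2 ^ M : ℕ) : ℤ), h1Eval W (2 : ℤ) y h ≠ 0) :
    ∃ ℓ : ℕ, ∃ _ : Fact ℓ.Prime, ℓ ∉ B₀ ∧ m ∣ ℓ + 1 ∧ IsKolyvaginPrime N W K 2 ℓ ∧
      FrobEqFrobInfty W K (2 ^ M) ℓ ∧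
      x ∉ W.torsionLocalKer ℚ_[ℓ] (2 : ℤ) ∧ y ∉ W.torsionLocalKer ℚ_[ℓ] (2 : ℤ) := by
  classical
  obtain ⟨c₀, hc₀⟩ := exists_isComplexConjugation (Rat.castHom ℝ)
  haveI : Algebra.IsQuadraticExtension ℚ K := ⟨hK.1⟩
  haveI : IsTotallyComplex K := hK.2
  set H := (absGaloisRestrict ℚ K).range with hH
  have hHi : H.index = 2 := (index_range_absGaloisRestrict_eq_finrank ℚ K).trans hK.1
  haveI hHn : H.Normal := Subgroup.normal_of_index_eq_two hHi
  have hA : ∀ γ δ : absoluteGaloisGroup ℚ, γ * δ * γ⁻¹ * δ⁻¹ ∈ H := fun γ δ ↦ by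
    rw [Subgroup.mul_mem_iff_of_index_two hHi, Subgroup.mul_mem_iff_of_index_two hHi,
      Subgroup.mul_mem_iff_of_index_two hHi, inv_mem_iff, inv_mem_iff]
    tauto
  have hHopen : IsOpen (H : Set (absoluteGaloisGroup ℚ)) := by
    have h := (isOpenMap_absGaloisRestrict (K := K)) _ isOpen_univ
    rw [Set.image_univ] at h
    convert h using 1
    ext σ
    simp only [hH, SetLike.mem_coe, MonoidHom.mem_range, Set.mem_range]
    rfl
  set B : Finset ℕ := B₀ ∪ N.primeFactors ∪ (NumberField.discr K).natAbs.primeFactors ∪ {2} with hB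
  set S' : Set (HeightOneSpectrum (𝓞 ℚ)) := {v | ¬ Algebra.IsUnramifiedIn (𝓞 K) v.asIdeal} with hS'
  have hS'fin : S'.Finite := finite_setOf_not_isUnramifiedIn ℚ K
  obtain ⟨ℓ, hℓF, hℓB, hℓm, hmdvd, ⟨v, 𝔓₀, t, hvS', hℓv, h𝔓₀, hF, htT, htH⟩, hxℓ, hyℓ⟩ :=
    exists_twistingPrime_pair_pow W hsurj hΔ hc₀ hM H hHopen hA hm hx hy B hS'fin
  have hℓ : ℓ.Prime := hℓF.out
  simp only [hB, Finset.mem_union, Finset.mem_singleton, Nat.mem_primeFactors, not_or] at hℓB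
  obtain ⟨⟨⟨hℓB₀, hℓN⟩, hℓD⟩, hℓ2⟩ := hℓB
  have hℓN' : ¬ ℓ ∣ N := fun h ↦ hℓN ⟨hℓ, h, NeZero.ne N⟩
  have hℓD' : ¬ ((ℓ : ℤ) ∣ NumberField.discr K) := fun h ↦
    hℓD ⟨hℓ, Int.natAbs_dvd_natAbs.mpr h |>.trans (by simp), by simp [NumberField.discr_ne_zero]⟩
  have hunr : Algebra.IsUnramifiedIn (𝓞 K) v.asIdeal := by
    by_contra h; exact hvS' h
  -- ### `ℓ` is inert in `K` (McCallum Cor. 3.2 (1) ⟹ inertness, via `FrobeniusPlaces`)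
  have hI := inertia_le_range_absGaloisRestrict_of_isUnramifiedIn (K := K) hunr h𝔓₀
  have hΦH : c₀ * t ∉ H := by
    intro h
    apply hc₀.not_mem_range_absGaloisRestrict (L := K) IsTotallyComplex.isComplex
    change c₀ ∈ ((absGaloisRestrict ℚ K).range : Set (absoluteGaloisGroup ℚ))
    have h' : c₀ = c₀ * t * t⁻¹ := by group
    rw [SetLike.mem_coe, h']
    exact Subgroup.mul_mem _ h (Subgroup.inv_mem _ htH)
  obtain ⟨w, 𝔔, τ', hwv, hwuniq, -, -, -, -, -⟩ :=
    exists_place_inert_of_not_mem_range (F := ℚ) (M := K) (hK.1 ▸ Nat.prime_two) hHn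
      (index_range_absGaloisRestrict_eq_finrank ℚ K) hunr h𝔓₀ hI hF hΦH
  have hwuniq' : ∀ w' : HeightOneSpectrum (𝓞 K), (ℓ : 𝓞 K) ∈ w'.asIdeal → w' = w := by
    intro w' hw'
    apply hwuniq
    apply HeightOneSpectrum.eq_of_natCast_mem_rat hℓ _ hℓv
    rw [HeightOneSpectrum.under_asIdeal, Ideal.under_def, Ideal.mem_comap, map_natCast]
    exact hw'
  have hspan : Ideal.span {(ℓ : 𝓞 K)} = w.asIdeal := by
    apply span_natCast_eq_of_unique hℓ w hwuniq'
    haveI : w.asIdeal.LiesOver v.asIdeal := ⟨by rw [← hwv]; rfl⟩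
    have hmap : v.asIdeal.map (algebraMap (𝓞 ℚ) (𝓞 K)) = Ideal.span {(ℓ : 𝓞 K)} := by
      rw [← span_natCast_rat_eq hℓ hℓv, Ideal.map_span, Set.image_singleton, map_natCast]
    have hne : v.asIdeal.map (algebraMap (𝓞 ℚ) (𝓞 K)) ≠ ⊥ := by
      rw [hmap, Ne, Ideal.span_singleton_eq_bot]; exact_mod_cast hℓ.ne_zero
    rw [← hmap, ← Ideal.IsDedekindDomain.ramificationIdx_eq_normalizedFactors_count v.asIdeal
      w.asIdeal hne]
    exact Ideal.ramificationIdx_eq_one_iff.mpr (hunr w.asIdeal w.isPrime inferInstance)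
  -- ### `Frob(ℓ) = Frob(∞)` on `E[2^M]` (hence on `E[2]`) and on `K`
  obtain ⟨g, hg⟩ := htH
  have hg' : absGaloisRestrict ℚ K g = t := hg
  have hK' : ∀ (e : K →ₐ[ℚ] AlgebraicClosure ℚ) (z : K), (c₀ * t) • e z = c₀ • e z := fun e z ↦ by
    rw [mul_smul, ← hg', absGaloisRestrict_smul_apply_eq g e z]
  have hFrobM : FrobEqFrobInfty W K (2 ^ M) ℓ :=
    ⟨v, 𝔓₀, c₀ * t, c₀, hℓv, h𝔓₀, hF, hc₀, fun P ↦ by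
      rw [mul_smul]; exact congrArg (c₀ • ·) (smul_eq_of_mem_torsionFixing W _ htT P), hK'⟩
  have hFrob1 : FrobEqFrobInfty W K 2 ℓ :=
    FrobEqFrobInfty.of_dvd (W := W) (K := K) (dvd_pow_self 2 (by omega)) hFrobM
  exact ⟨ℓ, hℓF, hℓB₀, hmdvd, ⟨hℓ, hℓN', hℓD', hℓ2, hspan ▸ w.isPrime, hFrob1⟩, hFrobM, hxℓ, hyℓ⟩

end DepthKolyvagin

/-! ## §19 The pair `(E, E^{(d)})` at depth `M`; the GENUS PAIR at a depth-`M` Kolyvagin prime is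
`2`-Selmer-minimal (mod Cor. 3.4 (i) + non-entanglement) -/

section DepthTwin

universe u

/-- A `Γ_K`-equivariant isomorphism `E'[n] ≃ E[n]` identifies `Γ_{K(E[n])}` and `Γ_{K(E'[n])}` (one
inclusion; the other by symmetry). [folklore] -/
theorem torsionFixing_le_of_equivariant_addEquiv {K : Type u} [Field K] (X' X : WeierstrassCurve K) (n : ℤ)
    (ψ : geomTorsion X' n ≃+ geomTorsion X n)
    (hψ : ∀ (g : absoluteGaloisGroup K) (t : geomTorsion X' n), ψ (g • t) = g • ψ t) :
    torsionFixing X n ≤ torsionFixing X' n := by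
  intro ρ hρ
  rw [mem_torsionFixing_iff] at hρ ⊢
  intro t
  apply ψ.injective
  rw [hψ, hρ]

variable (W : WeierstrassCurve ℚ) [W.IsElliptic] {K : Type} [Field K] [NumberField K]

/-- **KOLYVAGIN TWISTING PRIMES OF DEPTH `M` FOR THE PAIR `(E, E^{(d)})`, under non-entanglement.**
`W/ℚ` elliptic with `Δ(W) < 0` and `ρ̄_{W,2}` onto, `K` imaginary quadratic, `Wd` any elliptic model of a
quadratic twist `W^{(d)}` (`d ≠ 0`), `c ∈ H¹(ℚ, E[2])`, `c' ∈ H¹(ℚ, E^{(d)}[2])`, `M ≥ 1`, `m ≥ 1`, `N ≥ 1`,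
`B₀` finite. HYPOTHESIS: `c` does not die on `Γ_{ℚ(E[2^M])}`, and `c'` — evaluated through
`E^{(d)}[2] = E[2]` — does not die on `Γ_{ℚ(E[2^M])}` either (`[c', h] ≠ 0` for some `h` fixing `E[2^M]`;
such `h` fix `E^{(d)}[2] = E[2]`). THEN: a prime `ℓ ∉ B₀`, `m ∣ ℓ + 1`, Kolyvagin for `(E, K, 2)` in
Gross's sense AND of depth `M` (`FrobEqFrobInfty W K (2^M) ℓ`), with `c_ℓ ≠ 0` in `H¹(ℚ_ℓ, E[2])` and
`c'_ℓ ≠ 0` in `H¹(ℚ_ℓ, E^{(d)}[2])`. Transport `c'` along `E^{(d)}[2] ≅ E[2]` (`…TwistingPrimeTwin` §§11–12)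
and apply `exists_kolyvaginPrime_pow_not_mem_torsionLocalKer_pair`.
[cite: MazurRubin2010, Remark 2.4, Prop. 3.3, Lemma 3.5] [cite: GrossLMS1991, §3 (3.1)–(3.3), §9 Prop. 9.6]
[cite: McCallumLMS1991, §4 (Kolyvagin primes of level M)] -/
theorem exists_kolyvaginPrime_pow_not_mem_torsionLocalKer_twin (hsurj : W.HasSurjectiveModNGaloisRep 2)
    (hΔ : W.Δ < 0) (hK : IsImaginaryQuadratic K) {M : ℕ} (hM : 1 ≤ M) {d : ℚ} (hd : d ≠ 0)
    {Wd : WeierstrassCurve ℚ} [Wd.IsElliptic] {C : VariableChange ℚ} (hWd : C • W.quadraticTwist d = Wd)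
    {c : galH1Torsion W (2 : ℤ)} {c' : galH1Torsion Wd (2 : ℤ)}
    (hc : ∃ h ∈ torsionFixing W ((2 ^ M : ℕ) : ℤ), h1Eval W (2 : ℤ) c h ≠ 0)
    (hc' : ∃ h ∈ torsionFixing W ((2 ^ M : ℕ) : ℤ), h1Eval Wd (2 : ℤ) c' h ≠ 0)
    {m : ℕ} (hm : m ≠ 0) (N : ℕ) [NeZero N] (B₀ : Finset ℕ) :
    ∃ ℓ : ℕ, ∃ _ : Fact ℓ.Prime, ℓ ∉ B₀ ∧ m ∣ ℓ + 1 ∧ IsKolyvaginPrime N W K 2 ℓ ∧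
      FrobEqFrobInfty W K (2 ^ M) ℓ ∧
      c ∉ W.torsionLocalKer ℚ_[ℓ] (2 : ℤ) ∧ c' ∉ Wd.torsionLocalKer ℚ_[ℓ] (2 : ℤ) := by
  obtain ⟨ψ, hψ⟩ := exists_equivariant_addEquiv_geomTorsion_two_of_twist W hd hWd
  obtain ⟨Ψ, hinj, hΨeval, hker⟩ := exists_h1Map_of_equivariant_addEquiv Wd W (2 : ℤ) ψ hψ
  have h2M : (2 : ℤ) ∣ ((2 ^ M : ℕ) : ℤ) := by
    rw [Nat.cast_pow, Nat.cast_ofNat]; exact dvd_pow_self 2 (by omega : M ≠ 0)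
  have hTM : torsionFixing W ((2 ^ M : ℕ) : ℤ) ≤ torsionFixing W (2 : ℤ) := KolyvaginLowerBoundAtTwo.torsionFixing_le_of_dvd W h2M
  have hTd : torsionFixing W (2 : ℤ) ≤ torsionFixing Wd (2 : ℤ) :=
    torsionFixing_le_of_equivariant_addEquiv Wd W (2 : ℤ) ψ hψ
  have hy : ∃ h ∈ torsionFixing W ((2 ^ M : ℕ) : ℤ), h1Eval W (2 : ℤ) (Ψ c') h ≠ 0 := by
    obtain ⟨h, hT, hh⟩ := hc'
    refine ⟨h, hT, ?_⟩
    rw [hΨeval c' (hTM hT) (hTd (hTM hT))]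
    exact fun h0 ↦ hh (ψ.injective (h0.trans (map_zero ψ).symm))
  obtain ⟨ℓ, hℓF, hℓB₀, hmdvd, hKoly, hFrobM, hcℓ, hyℓ⟩ :=
    exists_kolyvaginPrime_pow_not_mem_torsionLocalKer_pair W hsurj hΔ hK hM hm N B₀ hc hy
  refine ⟨ℓ, hℓF, hℓB₀, hmdvd, hKoly, hFrobM, hcℓ, fun h' ↦ hyℓ ?_⟩
  have hsurj' : Function.Surjective (torsionPointsMap Wd ℚ_[ℓ] (2 : ℤ)) :=
    (torsionPointsMap_bijective Wd ℚ_[ℓ] (n := 2) two_ne_zero).2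
  exact hker ℚ_[ℓ] hsurj' c' h'

/-- **The same in Mazur–Rubin's currency.** If SOME Selmer class of `W` and SOME Selmer class of `Wd`
do not die on `Γ_{ℚ(E[2^M])}` (at `M = 1`: `#Sel₂ ≠ 1` for both), then beyond every finite set there is a
Kolyvagin prime `ℓ` for `(E, K, 2)` of depth `M` with `m ∣ ℓ + 1` at which NEITHER `Sel₂(W)` NOR `Sel₂(Wd)`
is strict. [cite: MazurRubin2010, Prop. 3.3, Cor. 3.4 (i), Lemma 3.5] [cite: GrossLMS1991, §9 Prop. 9.6] -/
theorem exists_kolyvaginPrime_pow_not_selmerGroup_le_strictLocalKer_twin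
    (hsurj : W.HasSurjectiveModNGaloisRep 2) (hΔ : W.Δ < 0) (hK : IsImaginaryQuadratic K) {M : ℕ}
    (hM : 1 ≤ M) {d : ℚ} (hd : d ≠ 0) {Wd : WeierstrassCurve ℚ} [Wd.IsElliptic] {C : VariableChange ℚ}
    (hWd : C • W.quadraticTwist d = Wd)
    (hS : ∃ c ∈ W.selmerGroup 2, ∃ h ∈ torsionFixing W ((2 ^ M : ℕ) : ℤ), h1Eval W (2 : ℤ) c h ≠ 0)
    (hS' : ∃ c' ∈ Wd.selmerGroup 2, ∃ h ∈ torsionFixing W ((2 ^ M : ℕ) : ℤ), h1Eval Wd (2 : ℤ) c' h ≠ 0)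
    {m : ℕ} (hm : m ≠ 0) (N : ℕ) [NeZero N] (B₀ : Finset ℕ) :
    ∃ ℓ : ℕ, ∃ _ : Fact ℓ.Prime, ℓ ∉ B₀ ∧ m ∣ ℓ + 1 ∧ IsKolyvaginPrime N W K 2 ℓ ∧
      FrobEqFrobInfty W K (2 ^ M) ℓ ∧
      ¬ W.selmerGroup 2 ≤ MazurRubin2010.strictLocalKer W ℚ_[ℓ] 2 ∧
      ¬ Wd.selmerGroup 2 ≤ MazurRubin2010.strictLocalKer Wd ℚ_[ℓ] 2 := by
  obtain ⟨c, hcS, hc⟩ := hS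
  obtain ⟨c', hcS', hc'⟩ := hS'
  obtain ⟨ℓ, hℓF, hℓB₀, hmdvd, hKoly, hFrobM, hcℓ, hcℓ'⟩ :=
    exists_kolyvaginPrime_pow_not_mem_torsionLocalKer_twin W hsurj hΔ hK hM hd hWd hc hc' hm N B₀
  exact ⟨ℓ, hℓF, hℓB₀, hmdvd, hKoly, hFrobM, fun hle ↦ hcℓ (hle hcS), fun hle ↦ hcℓ' (hle hcS')⟩

end DepthTwin

section DepthGenusPair

variable (W : WeierstrassCurve ℚ) [W.IsElliptic] [W.IsGloballyMinimal] {K : Type} [Field K] [NumberField K]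

/-- **PRIME-LEVEL SUPPLY OF THE LEVEL LAW AT DEPTH `M`, SELMER SIDE, modulo Mazur–Rubin Cor. 3.4 (i) and
NON-ENTANGLEMENT at level `2^M`.** Let `W/ℚ` be globally minimal elliptic with `Δ(W) < 0`, `ρ̄_{W,2}` onto and
`#Sel₂(W) = 4` (WALL row 1), `K` imaginary quadratic, `Wd` a globally minimal model of the twin `W^{(d_K)}`
with `#Sel₂(Wd) = 2`, `M ≥ 1`. ASSUME some Selmer class of `W` and the (some) Selmer class of `Wd` do not die
on `Γ_{ℚ(E[2^M])}` (at `M = 1` automatic; at `M ≥ 2` this EXCLUDES the «entangled» twins of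
`Lines/genus-supply-depthlaw.md` §2 / MEMO-es §13, whose Selmer direction is inflated from `ℚ(E[4])` and
localises to `0` at every depth-`2` prime). THEN beyond every finite `B₀` there is a prime `ℓ ≡ 7 (mod 8)`,
Kolyvagin for `(E, K, 2)` in Gross's sense AND OF DEPTH `M` — `FrobEqFrobInfty W K (2^M) ℓ`, `2^M ∣ ℓ + 1`,
`2^M ∣ a_ℓ(W)` — such that EVERY elliptic model of `W^{(−ℓ)}` has `#Sel₂ = 2` and every elliptic model of
`Wd^{(−ℓ)}` has `#Sel₂ = 1` (`−ℓ = ℓ*`): the genus pair `(E^{(ℓ*)}, E^{(ℓ*d_K)})` at a DEPTH-`M` Kolyvagin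
prime is `2`-Selmer-minimal. At `M = 2` these are exactly the primes `ℓ` + the Sel₂-trivial even genus twist
that the lead's AUXILIARY-FIELD FORM of U (`GenusKoly.multiGenusPrimitivityAtTwo_of_auxFieldPrimitive`, p615396;
`Lines/genus-supply-local.md` §2) consumes — its SUPPLY half, kernel-closed modulo cor34i (PRINT) and the
non-entanglement of the twin's Selmer class; the other half (the `2`-primitivity of the reduced genus point
`W_ℓ` in `E(ℚ(√−ℓ))`, EXACT-INDEX₂) is the open kernel and is untouched. BSD is not proved by this.
[cite: MazurRubin2010, Cor. 3.4 (i), Prop. 3.3, Lemma 3.5] [cite: GrossLMS1991, §3 (3.1)–(3.3)]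
[cite: McCallumLMS1991, §4 (Kolyvagin primes of level M)] -/
theorem exists_kolyvaginPrime_pow_genusPair_selmer_of_cor34i (h34 : MazurRubin2010.cor34i_singleton_rat)
    (hsurj : W.HasSurjectiveModNGaloisRep 2) (hΔ : W.Δ < 0) (h4 : Nat.card (W.selmerGroup 2) = 4)
    (hK : IsImaginaryQuadratic K) {Wd : WeierstrassCurve ℚ} [Wd.IsElliptic] [Wd.IsGloballyMinimal]
    {C : VariableChange ℚ} (hWd : C • W.quadraticTwist (discr K : ℚ) = Wd)
    (h2 : Nat.card (Wd.selmerGroup 2) = 2) {M : ℕ} (hM : 1 ≤ M)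
    (hS : ∃ c ∈ W.selmerGroup 2, ∃ h ∈ torsionFixing W ((2 ^ M : ℕ) : ℤ), h1Eval W (2 : ℤ) c h ≠ 0)
    (hS' : ∃ c' ∈ Wd.selmerGroup 2, ∃ h ∈ torsionFixing W ((2 ^ M : ℕ) : ℤ), h1Eval Wd (2 : ℤ) c' h ≠ 0)
    (B₀ : Finset ℕ) :
    ∃ ℓ : ℕ, ∃ _ : Fact ℓ.Prime, ℓ ∉ B₀ ∧ ℓ % 8 = 7 ∧ IsKolyvaginPrime (W.conductorNorm ℤ) W K 2 ℓ ∧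
      FrobEqFrobInfty W K (2 ^ M) ℓ ∧ 2 ^ M ∣ ℓ + 1 ∧ ((2 : ℤ) ^ M) ∣ W.frobeniusTrace ℓ ∧
      (∀ (W₁ : WeierstrassCurve ℚ) [W₁.IsElliptic],
        (∃ C₁ : VariableChange ℚ, C₁ • W.quadraticTwist (-(ℓ : ℚ)) = W₁) →
          Nat.card (W₁.selmerGroup 2) = 2) ∧
      (∀ (W₂ : WeierstrassCurve ℚ) [W₂.IsElliptic],
        (∃ C₂ : VariableChange ℚ, C₂ • Wd.quadraticTwist (-(ℓ : ℚ)) = W₂) →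
          Nat.card (W₂.selmerGroup 2) = 1) := by
  have hNW : W.conductorNorm ℤ ≠ 0 := (W.conductorNorm_pos_holds).ne'
  have hNWd : Wd.conductorNorm ℤ ≠ 0 := (Wd.conductorNorm_pos_holds).ne'
  haveI : NeZero (W.conductorNorm ℤ) := ⟨hNW⟩
  have hd0 : (discr K : ℚ) ≠ 0 := by exact_mod_cast NumberField.discr_ne_zero K
  have hm : 8 * W.conductorNorm ℤ * Wd.conductorNorm ℤ ≠ 0 := by positivity
  obtain ⟨ℓ, hℓF, hℓB₀, hmdvd, hKoly, hFrobM, hnsW, hnsWd⟩ :=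
    exists_kolyvaginPrime_pow_not_selmerGroup_le_strictLocalKer_twin W hsurj hΔ hK hM hd0 hWd hS hS' hm
      (W.conductorNorm ℤ) B₀
  have hℓ : ℓ.Prime := hℓF.out
  have hℓ8 : ℓ % 8 = 7 := by
    have h8 : 8 ∣ ℓ + 1 := (Dvd.intro _ rfl).trans ((Dvd.intro _ rfl).trans hmdvd)
    omega
  have hℓ2 : ℓ ≠ 2 := by omega
  -- depth: `2^M ∣ ℓ + 1` and `2^M ∣ a_ℓ` (good reduction at `ℓ ∤ N_W`)
  have hdepth1 : 2 ^ M ∣ ℓ + 1 := pow_dvd_add_one_of_frobEqFrobInfty W Nat.prime_two hM hℓ hℓ2 hFrobM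
  have hdepth2 : ((2 : ℤ) ^ M) ∣ W.frobeniusTrace ℓ := by
    have hF' := hFrobM
    obtain ⟨v, -, -, -, hℓv, -⟩ := hF'
    have hℓN : ¬ ℓ ∣ W.conductorNorm ℤ := hKoly.2.1
    have hgood : W.HasGoodReductionAt v := by
      apply hasGoodReductionAt_of_not_dvd_conductorNorm W v
      rw [primesEquiv_eq_of_natCast_mem hℓ hℓv]; exact hℓN
    have h := pow_dvd_frobeniusTraceAt_of_frobEqFrobInfty W Nat.prime_two hM hℓ hℓ2 hFrobM hℓv hgood
    rw [frobeniusTraceAt_eq_frobeniusTrace, primesEquiv_eq_of_natCast_mem hℓ hℓv] at h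
    exact_mod_cast h
  have hcong : ∀ (M' : ℕ), M' ∣ 8 * W.conductorNorm ℤ * Wd.conductorNorm ℤ →
      ∀ p : ℕ, p.Prime → p ∣ M' → p ≠ 2 → (ℓ : ZMod p) = -1 := by
    intro M' hM' p _ hp _
    have h : ((ℓ + 1 : ℕ) : ZMod p) = 0 :=
      (ZMod.natCast_eq_zero_iff _ _).mpr (hp.trans (hM'.trans hmdvd))
    rw [Nat.cast_add, Nat.cast_one] at h
    exact eq_neg_of_add_eq_zero_left h
  have hℓN : ∀ p : ℕ, p.Prime → p ∣ W.conductorNorm ℤ → p ≠ 2 → (ℓ : ZMod p) = -1 :=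
    hcong _ ⟨8 * Wd.conductorNorm ℤ, by ring⟩
  have hℓNd : ∀ p : ℕ, p.Prime → p ∣ Wd.conductorNorm ℤ → p ≠ 2 → (ℓ : ZMod p) = -1 :=
    hcong _ ⟨8 * W.conductorNorm ℤ, by ring⟩
  -- the genus twist of `W`
  have hW₁ : ∀ (W₁ : WeierstrassCurve ℚ) [W₁.IsElliptic],
      (∃ C₁ : VariableChange ℚ, C₁ • W.quadraticTwist (-(ℓ : ℚ)) = W₁) →
        Nat.card (W₁.selmerGroup 2) = 2 := by
    intro W₁ _ hW₁
    obtain ⟨-, -, K₁, _, _, hK₁, hd₁, hodd₁, -, hH₁, h2K₁, -, -⟩ :=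
      GenusKolyTwin.exists_heegnerField_of_prime W hℓ hℓ8 hℓN
    have hW₁' : ∃ C₁ : VariableChange ℚ, C₁ • W.quadraticTwist (discr K₁ : ℚ) = W₁ := by
      rw [hd₁]; push_cast; exact hW₁
    exact (GenusKolyTwin.natCard_selmerGroup_twin_eq_two_iff_not_strict W h34 hΔ hK₁ hodd₁ hH₁ h2K₁
      hd₁ W₁ hW₁' h4).mpr hnsW
  -- the genus twist of the twin
  have hΔd : Wd.Δ < 0 := by
    rw [← hWd, variableChange_Δ, quadraticTwist_Δ]
    have hu : (0 : ℚ) < ((C.u⁻¹ : ℚˣ) : ℚ) ^ 12 := Even.pow_pos (by decide) (Units.ne_zero _)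
    have hd6 : (0 : ℚ) < (discr K : ℚ) ^ 6 := Even.pow_pos (by decide) hd0
    nlinarith [mul_pos hu hd6]
  have hW₂ : ∀ (W₂ : WeierstrassCurve ℚ) [W₂.IsElliptic],
      (∃ C₂ : VariableChange ℚ, C₂ • Wd.quadraticTwist (-(ℓ : ℚ)) = W₂) →
        Nat.card (W₂.selmerGroup 2) = 1 := by
    intro W₂ _ hW₂
    obtain ⟨-, -, K₂, _, _, hK₂, hd₂, hodd₂, -, hH₂, h2K₂, -, -⟩ :=
      GenusKolyTwin.exists_heegnerField_of_prime Wd hℓ hℓ8 hℓNd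
    have hW₂' : ∃ C₂ : VariableChange ℚ, C₂ • Wd.quadraticTwist (discr K₂ : ℚ) = W₂ := by
      rw [hd₂]; push_cast; exact hW₂
    have h := (GenusKolyTwin.cor34i_twin_prime_heegner Wd h34 hΔd hK₂ hodd₂ hH₂ h2K₂ hd₂ W₂ hW₂').2
      hnsWd
    rw [h2] at h
    omega
  exact ⟨ℓ, hℓF, hℓB₀, hℓ8, hKoly, hFrobM, hdepth1, hdepth2, hW₁, hW₂⟩

end DepthGenusPair

end Summit.BirchSwinnertonDyer.BirchSwinnertonDyer.Theorems.GenusKolyTwistingPrime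

end
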